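import Literature.Analysis.FunctionSpaces.TorusWienerSobolevInterpolation
import Literature.Analysis.FunctionSpaces.TorusAgmonExplicit
import HarnessLib

/-!
# Agmon's inequality on `T²`: `‖v‖²_∞ ≤ C ‖v‖₂ ‖Δv‖₂` for zero-mean fields

Analysis/FunctionSpaces proof file (theorems only; no definitions, no named facts). The planar
case `(s₁, s₂) = (0, 2)`, `n = 2` of the tree's fractional Agmon inequality
`Torus.exists_norm_le_hsSeminorm_interpolation` (Robinson–Sadowski–Silva 2012, Lemma 3.2 with
(3.2)): for every smooth zero-mean `v : T² → ℝ²` and every `x`,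
`‖v(x)‖² ≤ C · ‖v‖_{L²} · ‖Δv‖_{L²}`, with the Fourier sums identified with `∫‖v‖²` (Parseval) and
`∫‖Δv‖²` (tree `Torus.hasSum_freq_sq_mul_norm_sq_mFourierCoeff`). Requested by the
SawtoothPulseCascade line `lip-agmon` (Lipschitz envelope via Agmon on `∂ⱼL`).

## Mathlib / tree search

Tree (reused): `Torus.exists_norm_le_hsSeminorm_interpolation`, `Torus.hasSum_sq_mFourierCoeff_euclidean`,
`Torus.hasSum_freq_sq_mul_norm_sq_mFourierCoeff`; the `T³` explicit version is
`Torus.norm_sq_le_two_div_pi_sq_mul_sqrt`. Searched `agmon.*fin_two`, `norm_sq_le.*laplacian.*Fin 2`: nothing.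

## References

* J. C. Robinson, W. Sadowski, R. P. Silva, J. Math. Phys. 53 (2012) 115618, Lemma 3.2, (3.2), (3.10). [RobinsonSadowskiSilva2012]
* S. Agmon, *Lectures on elliptic boundary value problems* (1965), §13 Lemma 13.2. [Agmon1965]
-/

noncomputable section

open MeasureTheory Set Filter Topology Real UnitAddTorus
open scoped ENNReal NNReal

namespace Literature.Analysis.FunctionSpaces

namespace Torus

/-- **Agmon's inequality on `T²`.** There is `C > 0` such that every smooth zero-mean
`v : T² → ℝ²` satisfies, at every point, `‖v(x)‖² ≤ C · (∫‖v‖²)^{1/2} · (∫‖Δv‖²)^{1/2}`.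
[cite: RobinsonSadowskiSilva2012, Lemma 3.2 with (3.2) (n = 2, s₁ = 0, s₂ = 2)] -/
theorem exists_norm_sq_le_agmon_fin_two :
    ∃ C : ℝ, 0 < C ∧ ∀ v : UnitAddTorus (Fin 2) → EuclideanSpace ℝ (Fin 2), IsSmooth v → HasZeroMean v →
      ∀ x : UnitAddTorus (Fin 2), ‖v x‖ ^ 2 ≤
        C * Real.sqrt (∫ y, ‖v y‖ ^ 2) * Real.sqrt (∫ y, ‖laplacian v y‖ ^ 2) := by
  have hcard : (Fintype.card (Fin 2) : ℝ) = 2 := by simp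
  obtain ⟨C, hC0, hC⟩ := exists_norm_le_hsSeminorm_interpolation (d := Fin 2) (s₁ := 0) (s₂ := 2)
    (by rw [hcard]; norm_num) (by rw [hcard]; norm_num)
  refine ⟨C ^ 2 / (4 * π ^ 2) + 1, by positivity, fun v hv hmean x => ?_⟩
  have h := hC v hv hmean x
  rw [hcard] at h
  have e1 : ((2 : ℝ) - 2 / 2) / (2 - 0) = 1 / 2 := by norm_num
  have e2 : ((2 : ℝ) / 2 - 0) / (2 - 0) = 1 / 2 := by norm_num
  rw [e1, e2] at h
  -- the two Fourier sums
  set S₀ : ℝ := ∑' k : Fin 2 → ℤ,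
    freqNormSq k ^ (0 : ℝ) * ‖mFourierCoeff (EuclideanSpace.complexify ∘ v) k‖ ^ 2 with hS₀
  set S₂ : ℝ := ∑' k : Fin 2 → ℤ,
    freqNormSq k ^ (2 : ℝ) * ‖mFourierCoeff (EuclideanSpace.complexify ∘ v) k‖ ^ 2 with hS₂
  -- Parseval: `S₀ = ∫‖v‖²`
  have hP := hasSum_sq_mFourierCoeff_euclidean
    (EuclideanSpace.continuous_complexify.comp hv.continuous : Continuous (EuclideanSpace.complexify ∘ v))
  have hS₀eq : S₀ = ∫ y, ‖v y‖ ^ 2 := by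
    have e : (fun k : Fin 2 → ℤ => freqNormSq k ^ (0 : ℝ) * ‖mFourierCoeff (EuclideanSpace.complexify ∘ v) k‖ ^ 2) =
        fun k => ‖mFourierCoeff (EuclideanSpace.complexify ∘ v) k‖ ^ 2 := by
      funext k; rw [Real.rpow_zero, one_mul]
    rw [hS₀, e, hP.tsum_eq]
    refine integral_congr_ae (ae_of_all _ fun y => ?_)
    simp [Function.comp]
  -- `16π⁴ S₂ = ∫‖Δv‖²`
  have hB := hasSum_freq_sq_mul_norm_sq_mFourierCoeff hv
  have hS₂eq : S₂ = (∫ y, ‖laplacian v y‖ ^ 2) / (16 * π ^ 4) := by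
    have hπ : (0 : ℝ) < π := Real.pi_pos
    have h16 : (16 : ℝ) * π ^ 4 ≠ 0 := by positivity
    have hB' := hB.div_const (16 * π ^ 4)
    have e : (fun k : Fin 2 → ℤ => (4 * π ^ 2 * freqNormSq k) ^ 2 *
        ‖mFourierCoeff (EuclideanSpace.complexify ∘ v) k‖ ^ 2 / (16 * π ^ 4)) =
        fun k => freqNormSq k ^ (2 : ℝ) * ‖mFourierCoeff (EuclideanSpace.complexify ∘ v) k‖ ^ 2 := by
      funext k
      rw [Real.rpow_two]
      field_simp
      ring
    rw [e] at hB'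
    rw [hS₂, hB'.tsum_eq]
  have hS₀0 : 0 ≤ S₀ := by rw [hS₀eq]; positivity
  have hS₂0 : 0 ≤ S₂ := by rw [hS₂eq]; positivity
  -- square the interpolation inequality
  have hv0 : 0 ≤ ‖v x‖ := norm_nonneg _
  have hrhs0 : 0 ≤ C * Real.sqrt S₀ ^ (1 / 2 : ℝ) * Real.sqrt S₂ ^ (1 / 2 : ℝ) := by positivity
  have hsq : ‖v x‖ ^ 2 ≤ (C * Real.sqrt S₀ ^ (1 / 2 : ℝ) * Real.sqrt S₂ ^ (1 / 2 : ℝ)) ^ 2 :=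
    pow_le_pow_left₀ hv0 h 2
  have hhalf : ∀ {a : ℝ}, 0 ≤ a → (a ^ (1 / 2 : ℝ)) ^ 2 = a := by
    intro a ha
    rw [← Real.rpow_natCast, ← Real.rpow_mul ha]
    norm_num
  have hexp : (C * Real.sqrt S₀ ^ (1 / 2 : ℝ) * Real.sqrt S₂ ^ (1 / 2 : ℝ)) ^ 2 =
      C ^ 2 * Real.sqrt S₀ * Real.sqrt S₂ := by
    rw [mul_pow, mul_pow, hhalf (Real.sqrt_nonneg _), hhalf (Real.sqrt_nonneg _)]
  rw [hexp] at hsq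
  -- identify and compare constants
  have hsqrt2 : Real.sqrt S₂ = Real.sqrt (∫ y, ‖laplacian v y‖ ^ 2) / (4 * π ^ 2) := by
    rw [hS₂eq, Real.sqrt_div' _ (by positivity : (0 : ℝ) ≤ 16 * π ^ 4)]
    congr 1
    rw [show (16 : ℝ) * π ^ 4 = (4 * π ^ 2) ^ 2 by ring, Real.sqrt_sq (by positivity)]
  rw [hS₀eq, hsqrt2] at hsq
  have hA0 : 0 ≤ Real.sqrt (∫ y, ‖v y‖ ^ 2) := Real.sqrt_nonneg _
  have hB0 : 0 ≤ Real.sqrt (∫ y, ‖laplacian v y‖ ^ 2) := Real.sqrt_nonneg _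
  have hπ2 : (0 : ℝ) < 4 * π ^ 2 := by positivity
  have hAB : 0 ≤ Real.sqrt (∫ y, ‖v y‖ ^ 2) * Real.sqrt (∫ y, ‖laplacian v y‖ ^ 2) := mul_nonneg hA0 hB0
  have e3 : C ^ 2 * Real.sqrt (∫ y, ‖v y‖ ^ 2) * (Real.sqrt (∫ y, ‖laplacian v y‖ ^ 2) / (4 * π ^ 2)) =
      C ^ 2 / (4 * π ^ 2) * (Real.sqrt (∫ y, ‖v y‖ ^ 2) * Real.sqrt (∫ y, ‖laplacian v y‖ ^ 2)) := by
    ring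
  rw [e3] at hsq
  have e4 : (C ^ 2 / (4 * π ^ 2) + 1) * Real.sqrt (∫ y, ‖v y‖ ^ 2) * Real.sqrt (∫ y, ‖laplacian v y‖ ^ 2) =
      C ^ 2 / (4 * π ^ 2) * (Real.sqrt (∫ y, ‖v y‖ ^ 2) * Real.sqrt (∫ y, ‖laplacian v y‖ ^ 2)) +
        Real.sqrt (∫ y, ‖v y‖ ^ 2) * Real.sqrt (∫ y, ‖laplacian v y‖ ^ 2) := by
    ring
  rw [e4]
  linarith [hsq, hAB]

end Torus

end Literature.Analysis.FunctionSpaces
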